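import Summits.MatrixMultiplication.OmegaCensus.SmallFormats.MatMul227GF3FootprintBlocks
import Summits.MatrixMultiplication.OmegaCensus.SmallFormats.MatMul227GF3FootprintKillW
import HarnessLib

/-!
# ω-census family (a): `⟨2,2,7⟩ @ 23` over `𝔽₃` — the catalog hypothesis in BLOCK language: `24 ≤ R_𝔽₃(⟨2,2,7⟩)` from the (9,7) Weierstraß–Kronecker block form

Cell `pub-omega` (unit `pub-omega-tensor-g32`), topic `Summits/MatrixMultiplication/OmegaCensus` (sub-folder `SmallFormats`).
Framing (verbatim): lottery ticket; floor = certified bounds/negative ranges. HONEST FRAMING: a RESTATEMENT that makes the one remaining hypothesis of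
the `(7,23)` rung readable and citable. `blockRows_eq` (kernel `decide`): the row codes of the block pencils of the 2 255 listed block lists
(`blockListsW`, `MatMul227GF3FootprintBlocks`) ARE the codes of the irreducibility-free catalog (`catRowsWA ++ ⋯ ++ catRowsWE`, hence `catW2255`).
`KroneckerBlockForm97` states the `(9,7)` instance over `𝔽₃` of the Weierstraß–Kronecker theorem with the regular kernel in first natural normal form
(companion blocks; Gantmacher XII §5 with VI §6; BCS 1997 (19.2)–(19.3); finite fields: Dieudonné 1946 / Mirwald 1991), in subspace language: every
subspace of `𝔽₃^{2×7}` of dimension `≤ 9` whose members have no common nonzero right-kernel vector is carried by some `W ↦ W Q` (`Q ∈ GL₇`) into the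
row space of the block pencil of a listed block list. It is NOT proved here (it is the input of lane S2); `catalogCompleteK_catW2255_of_blockForm` and
`twentyfour_le_tensorRank_227_gf3_of_blockForm` turn it into `CatalogCompleteK 7 9 catW2255` and `24 ≤ R_𝔽₃(⟨2,2,7⟩)`. The first section gives the
DIGIT BRIDGE a derivation of the block form needs: `decB (blockRowsCode l) s r c` is the `(s, c)` entry of the `A`/`B` part of the block sum of `l`
(`decB_blockRowsCode`, via base-3 digit extraction `digit_sumNat`). Nothing on `ω`.
-/

namespace Summit.MatrixMultiplication.OmegaCensus.SmallFormats

open Module Matrix Literature.Computability.AlgebraicComplexity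

/-! ## Digits of the row codes (bridge from block lists to decoded matrices) -/

/-- Pointwise-equal summands give equal structural sums. -/
theorem sumNat_congr {n : ℕ} {f g : ℕ → ℕ} (h : ∀ q < n, f q = g q) : sumNat n f = sumNat n g := by
  induction n with
  | zero => rfl
  | succ n ih =>
      rw [sumNat, sumNat, ih (fun q hq => h q (Nat.lt_succ_of_lt hq)), h n (Nat.lt_succ_self n)]

/-- Splitting a structural sum. -/
theorem sumNat_add (m n : ℕ) (f : ℕ → ℕ) : sumNat (m + n) f = sumNat m f + sumNat n (fun q => f (m + q)) := by
  induction n with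
  | zero => simp [sumNat]
  | succ n ih => rw [Nat.add_succ, sumNat, ih, sumNat, Nat.add_assoc]

/-- A base-3 expansion with digits `< 3` is `< 3^L`. -/
theorem sumNat_digits_lt (L : ℕ) (d : ℕ → ℕ) (hd : ∀ q, d q < 3) : sumNat L (fun q => d q * 3 ^ q) < 3 ^ L := by
  induction L with
  | zero => simp [sumNat]
  | succ L ih =>
      rw [sumNat, Nat.pow_succ]
      have h1 := hd L
      have h2 : d L * 3 ^ L ≤ 2 * 3 ^ L := Nat.mul_le_mul_right _ (by omega)
      omega

/-- **Digit extraction**: digit `p` of `Σ_{q<L} d_q 3^q` is `d_p` (`d_q < 3`, `p < L`). -/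
theorem digit_sumNat (L : ℕ) (d : ℕ → ℕ) (hd : ∀ q, d q < 3) (p : ℕ) (hp : p < L) :
    sumNat L (fun q => d q * 3 ^ q) / 3 ^ p % 3 = d p := by
  induction L with
  | zero => exact absurd hp (Nat.not_lt_zero p)
  | succ L ih =>
      rw [sumNat]
      rcases Nat.lt_succ_iff_lt_or_eq.mp hp with h | rfl
      · -- p < L: the new top digit contributes a multiple of 3
        have hpow : 3 ^ L = 3 ^ p * (3 * 3 ^ (L - p - 1)) := by
          rw [← Nat.pow_succ', ← Nat.pow_add]; congr 1; omega
        rw [hpow, ← Nat.mul_assoc, Nat.mul_comm (d L), Nat.mul_assoc, Nat.add_mul_div_left _ _ (Nat.pow_pos (by norm_num) : 0 < 3 ^ p),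
          Nat.mul_left_comm, Nat.add_mul_mod_self_left, ih h]
      · -- p = L: the lower part is < 3^L
        have hlt := sumNat_digits_lt p d hd
        rw [Nat.add_mul_div_right _ _ (Nat.pow_pos (by norm_num) : 0 < 3 ^ p), Nat.div_eq_of_lt hlt, Nat.zero_add,
          Nat.mod_eq_of_lt (hd p)]

/-- Block entries are digits (`< 3`). -/
theorem PBlock.a_lt (blk : PBlock) (i j : ℕ) : blk.a i j < 3 := by
  cases blk <;> simp only [PBlock.a] <;> split_ifs <;> omega

/-- Block entries are digits (`< 3`). -/
theorem PBlock.b_lt (blk : PBlock) (i j : ℕ) : blk.b i j < 3 := by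
  cases blk <;> simp only [PBlock.b] <;> split_ifs <;> omega

/-- Block-sum entries are digits when the block entries are. -/
theorem bsEntry_lt (f : PBlock → ℕ → ℕ → ℕ) (hf : ∀ blk i j, f blk i j < 3) (l : List PBlock) (i j : ℕ) : bsEntry f l i j < 3 := by
  induction l generalizing i j with
  | nil => simp [bsEntry]
  | cons blk l ih =>
      simp only [bsEntry]
      split_ifs
      · exact hf blk i j
      · omega
      · omega
      · exact ih _ _

/-- The 14 digits of row `i`: `A`-entries then `B`-entries. -/
def rowDigit (l : List PBlock) (i q : ℕ) : ℕ := if q < 7 then bsEntry PBlock.a l i q else bsEntry PBlock.b l i (q - 7)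

/-- Row digits are `< 3`. -/
theorem rowDigit_lt (l : List PBlock) (i q : ℕ) : rowDigit l i q < 3 := by
  unfold rowDigit; split_ifs
  · exact bsEntry_lt _ PBlock.a_lt l i q
  · exact bsEntry_lt _ PBlock.b_lt l i (q - 7)

/-- `rowCode` is the base-3 number with digits `rowDigit`. -/
theorem rowCode_eq (l : List PBlock) (i : ℕ) : rowCode l i = sumNat 14 (fun q => rowDigit l i q * 3 ^ q) := by
  rw [rowCode, show (14 : ℕ) = 7 + 7 from rfl, sumNat_add]
  have h1 : sumNat 7 (fun q => rowDigit l i q * 3 ^ q) = sumNat 7 (fun c => bsEntry PBlock.a l i c * 3 ^ c) :=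
    sumNat_congr fun q hq => by rw [rowDigit, if_pos hq]
  have h2 : sumNat 7 (fun q => rowDigit l i (7 + q) * 3 ^ (7 + q)) = sumNat 7 (fun c => bsEntry PBlock.b l i c * 3 ^ (7 + c)) :=
    sumNat_congr fun q _ => by rw [rowDigit, if_neg (by omega), show 7 + q - 7 = q by omega]
  rw [h1, h2]

/-- **Decoding a block list's row code gives the block pencil's entries**: digit `7r + c` of `rowCode l i` is the `(i, c)` entry of the
`A`-part (`r = 0`) or the `B`-part (`r = 1`) of the block sum. -/
theorem rowCode_digit (l : List PBlock) (i r c : ℕ) (hr : r < 2) (hc : c < 7) :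
    rowCode l i / 3 ^ (7 * r + c) % 3 = if r = 0 then bsEntry PBlock.a l i c else bsEntry PBlock.b l i c := by
  rw [rowCode_eq, digit_sumNat 14 (rowDigit l i) (rowDigit_lt l i) _ (by omega), rowDigit]
  rcases (by omega : r = 0 ∨ r = 1) with rfl | rfl
  · rw [if_pos (by omega), if_pos rfl, show 7 * 0 + c = c by omega]
  · rw [if_neg (by omega), if_neg (by omega), show 7 * 1 + c - 7 = c by omega]

/-- The decoded catalog matrix of a block list's row `i`: entry `(r, c)` is the block pencil's `A`/`B` entry cast to `𝔽₃`. -/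
theorem decM_rowCode (l : List PBlock) (i : ℕ) (r : Fin 2) (c : Fin 7) :
    decM (rowCode l i) r c = ((if (r : ℕ) = 0 then bsEntry PBlock.a l i c else bsEntry PBlock.b l i c : ℕ) : ZMod 3) := by
  rw [decM_apply, trit, rowCode_digit l i r c r.2 c.2]

/-- Entries of the decoded catalog tuple of a block list: entry `(r, c)` of row `s` is the block pencil's `A`-entry (`r = 0`) / `B`-entry (`r = 1`)
at `(s, c)`, cast to `𝔽₃` — the bridge a derivation of `KroneckerBlockForm97` from a block-diagonal normal form needs. -/
theorem decB_blockRowsCode (l : List PBlock) (s : Fin 9) (r : Fin 2) (c : Fin 7) :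
    decB (blockRowsCode l) s r c =
      ((if (r : ℕ) = 0 then bsEntry PBlock.a l s c else bsEntry PBlock.b l s c : ℕ) : ZMod 3) := by
  rw [decB]
  simp only [blockRowsCode]
  rw [List.getD_eq_getElem _ _ (by simp), List.getElem_map, List.getElem_range]
  exact decM_rowCode l s r c

end Summit.MatrixMultiplication.OmegaCensus.SmallFormats

namespace Summit.MatrixMultiplication.OmegaCensus.SmallFormats.Enum723

open Module Matrix Literature.Computability.AlgebraicComplexity RankOnePlaneCapGeneral

set_option maxRecDepth 100000 in
set_option maxHeartbeats 400000000 in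
/-- **The catalog codes are the block pencils' codes** (kernel `decide`). -/
theorem blockRows_eq : blockListsW.map blockRowsCode = catRowsWA ++ catRowsWB ++ catRowsWC ++ catRowsWD ++ catRowsWE := by
  decide +kernel

/-- `catW2255` is the list of decoded block pencils of `blockListsW`. -/
theorem catW2255_eq : catW2255 = (blockListsW.map blockRowsCode).map decB := by
  rw [catW2255, blockRows_eq]

/-- **The (9,7) Weierstraß–Kronecker block form over `𝔽₃`, subspace version** (INPUT, not proved): every subspace `WW ⊆ 𝔽₃^{2×7}` with
`dim WW ≤ 9` and no common nonzero right-kernel vector is carried by an invertible right multiplication into the row space of the block pencil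
of one of the 2 255 block lists `blockListsW` (all block lists `L_ε (ε ≥ 1) ⊕ L_ηᵀ (η ≥ 1) ⊕ N_u ⊕ companion blocks` with 9 rows and 7 columns,
in the listed order). -/
def KroneckerBlockForm97 : Prop :=
  ∀ WW : Submodule (ZMod 3) (Matrix (Fin 2) (Fin 7) (ZMod 3)), finrank (ZMod 3) WW ≤ 9 →
    (∀ x : Fin 7 → ZMod 3, x ≠ 0 → ∃ W ∈ WW, W *ᵥ x ≠ 0) →
    ∃ l ∈ blockListsW, ∃ Q Q' : Matrix (Fin 7) (Fin 7) (ZMod 3), Q' * Q = 1 ∧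
      WW.map (mulRightLin (ZMod 3) Q) ≤ Submodule.span (ZMod 3) (Set.range (decB (blockRowsCode l)))

/-- The block form gives the completeness of `catW2255`. -/
theorem catalogCompleteK_catW2255_of_blockForm (h : KroneckerBlockForm97) : CatalogCompleteK 7 9 catW2255 := by
  intro WW hdim hsupp
  obtain ⟨l, hl, Q, Q', hQ, hle⟩ := h WW hdim hsupp
  refine ⟨decB (blockRowsCode l), ?_, Q, Q', hQ, hle⟩
  rw [catW2255_eq]
  exact List.mem_map.mpr ⟨blockRowsCode l, List.mem_map.mpr ⟨l, hl, rfl⟩, rfl⟩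

/-- **`24 ≤ R_𝔽₃(⟨2,2,7⟩)` from the (9,7) Weierstraß–Kronecker block form over `𝔽₃`** (the block form is the hypothesis). -/
theorem twentyfour_le_tensorRank_227_gf3_of_blockForm (h : KroneckerBlockForm97) :
    24 ≤ tensorRank (matMulTensor (ZMod 3) 2 2 7) :=
  twentyfour_le_tensorRank_227_gf3_of_catalogW2255 (catalogCompleteK_catW2255_of_blockForm h)

/-- **`R_𝔽₃(⟨2,2,7⟩) ∈ [24, 25]` from the (9,7) Weierstraß–Kronecker block form over `𝔽₃`.** -/
theorem tensorRank_227_gf3_mem_of_blockForm (h : KroneckerBlockForm97) :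
    tensorRank (matMulTensor (ZMod 3) 2 2 7) ∈ Set.Icc 24 25 :=
  tensorRank_227_gf3_mem_of_catalogW2255 (catalogCompleteK_catW2255_of_blockForm h)

end Summit.MatrixMultiplication.OmegaCensus.SmallFormats.Enum723
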